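import Summits.ResolutionOfSingularities.ResolutionOfSingularities.Theorems.MarkedTransferCampaignW46ThreefoldsGammaFreeGlobalLadder
import Literature.AlgebraicGeometry.Resolution.MarkedIdealsEtale
import Literature.AlgebraicGeometry.Resolution.BlowupsFlatBaseChange
import HarnessLib

/-!
# [OURS · L1 W4.6 rung (ii)] ÉTALE FUNCTORIALITY OF Γ-FREE ORDER REDUCIBILITY — sequences of permissible blowing-ups and
# `OrderReducible I m` pull back along étale morphisms (in particular restrict to open subschemes), PROVED

Cell res-hironaka, LADDER-RESOLUTION rung L (D-0089), slot W4.6, rung (ii) (threefold hypersurfaces) in the DIMENSION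
LADDER of the Γ-free global order-reduction statement (typer res-L1-type-o1: `…ThreefoldsGammaFreeGlobal.lean` p493059
`IsPermissibleBlowupSeq`; `…ThreefoldsGammaFreeGlobalLadder.lean` p496755 `OrderReducible I m`). Seat res-L1-s46-pv-3
(gen 3). Host route MarkedTransfer, host item `HypersurfaceOrderReductionDimLeThree` (stmt-ResolutionOfSingularities-16156);
filed `--kind proof --supports` it `--as helper`. Everything here is OURS: kernel theorems over the campaign definitions
and PROVED tree lemmas; NOTHING is a statement of Hironaka's manuscript; no typed `Hironaka2017` candidate enters; no named
FACT is a hypothesis. AI-written; AI review is weaker than expert review.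

## What is proved (no new definitions)

For a morphism `φ : X′ ⟶ X` which is flat, formally unramified and locally of finite type (e.g. ÉTALE, e.g. an OPEN
IMMERSION), `X` locally Noetherian:

* `CampaignW46.IsPermissibleBlowupSeq.isLocallyNoetherian` — every stage of a sequence of permissible blowing-ups over a
  locally Noetherian scheme is locally Noetherian (blow-ups of locally Noetherian schemes are proper, tree
  `IsBlowup.isProper` [Stacks 02NS]); no regularity needed (cf. `isLocallyNoetherian_and_isRegular` of p493059).
* `CampaignW46.IsPermissibleBlowupSeq.exists_isPullback_of_etale` — **the fibre product of a sequence of permissible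
  blowing-ups for `(J, b)` on `X` with `X′` is a sequence of permissible blowing-ups for `(φ^*J, b)` on `X′`**, with last
  transform the pull-back of the last transform: built stage by stage (`Bl_{ψᵢ^*Cᵢ} = Bl_{Cᵢ} ×_{Xᵢ} X′ᵢ`: blow-ups commute
  with flat base change, tree `IsBlowup.of_isPullback_of_flat` [GW Prop. 13.91]); the pulled-back centres are regular
  (`Scheme.IsRegular.subscheme_comap_of_etale` [Matsumura Thm. 23.7]) hence again reduced (`vanishingIdeal` of their
  support, `eq_vanishingIdeal_support_of_isRegular`), they lie in the order-`≥ b` locus because étale morphisms PRESERVE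
  orders (`idealOrder_comap_of_etale` [BGMW Lemma 8.0.3 (2)]), and controlled transforms commute with flat base change
  (`comap_controlledTransform_of_flat`). This is BGMW Thm. 8.0.5 for the campaign's localisation-free Def.-2.4 predicate
  (the tree proves it for BGMW multiple blow-ups, `IsMultipleBlowup.exists_isPullback_of_etale`; the present predicate has
  no boundary, so no simple-normal-crossings bookkeeping is needed).
* `CampaignW46.OrderReducible.comap_of_etale` — **`OrderReducible I m → OrderReducible (φ^* I) m`**.
* `CampaignW46.OrderReducible.restrict` — in particular **order-reducibility restricts to open subschemes**:
  `OrderReducible I m → OrderReducible (I.comap U.ι) m` for every open `U ⊆ X`.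

HONEST VALUE. A structural property of the CONCLUSION of the rung-(ii) statement of record (and of every rung of the
ladder), not a rung: étale-local stability downward (from `X` to an étale `X′ → X`). It lets a NEGATIVE on an open or
étale chart refute order-reducibility of the whole, and lets the ladder's rungs be read on étale covers; it does NOT
descend (an étale-local order reduction need not glue — that direction is where canonicity/functoriality of a
procedure is needed, and is not claimed).

References: `…ThreefoldsGammaFreeGlobal.lean` (p493059), `…ThreefoldsGammaFreeGlobalLadder.lean` (p496755); tree
`Resolution/MarkedIdealsEtale.lean` (`idealOrder_comap_of_etale`, `comap_controlledTransform_of_flat`,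
`Scheme.IsRegular.subscheme_comap_of_etale`, pattern `IsMultipleBlowup.exists_isPullback_of_etale`
[BierstoneGrigorievMilmanWlodarczyk2011, Lemma 8.0.3, Thm. 8.0.5]), `Resolution/BlowupsFlatBaseChange.lean`
(`IsBlowup.of_isPullback_of_flat` [GortzWedhorn2020, Prop. 13.91]), `Resolution/RegularSubschemeLocallyIrreducible.lean`
(`eq_vanishingIdeal_support_of_isRegular`), `Resolution/BlowupsProper*.lean` (`IsBlowup.isProper` [StacksProject, 02NS]).
H. Hironaka, ms. 2017-03-23, Def. 2.4 p.6 — scope only, under adjudication, not cited as fact. [Hironaka2017]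
-/

noncomputable section

set_option linter.dupNamespace false -- mandated namespace of this single-conjunct summit

open CategoryTheory CategoryTheory.Limits AlgebraicGeometry TopologicalSpace IsLocalRing

namespace Summit.ResolutionOfSingularities.ResolutionOfSingularities.Theorems

namespace CampaignW46

open Literature.AlgebraicGeometry.Resolution
open Scheme.IdealSheafData

universe u

namespace IsPermissibleBlowupSeq

variable {X : Scheme.{u}} {J : X.IdealSheafData} {b : ℕ}

/-- **All stages of a sequence of permissible blowing-ups over a locally Noetherian scheme are locally Noetherian**
(a blowing up of a locally Noetherian scheme is proper, in particular locally of finite type, tree `IsBlowup.isProper`;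
induction along the sequence). No regularity of `X` is needed. [cite: StacksProject, Tag 02NS] -/
theorem isLocallyNoetherian :
    ∀ {Z : Scheme.{u}} {σ : Z ⟶ X} {J' : Z.IdealSheafData}, IsPermissibleBlowupSeq J b σ J' →
      IsLocallyNoetherian X → IsLocallyNoetherian Z := by
  intro Z σ J' h hX
  induction h with
  | nil => exact hX
  | blowup h D π hreg hD hπ ih =>
    haveI := ih
    haveI : IsProper π := hπ.isProper
    exact LocallyOfFiniteType.isLocallyNoetherian π

variable {X' : Scheme.{u}} (φ : X' ⟶ X) [Flat φ] [FormallyUnramified φ] [LocallyOfFiniteType φ]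
  [IsLocallyNoetherian X]

/-- **ÉTALE PULL-BACK OF A SEQUENCE OF PERMISSIBLE BLOWING-UPS** (BGMW Thm. 8.0.5 for the campaign's localisation-free
Def.-2.4 predicate): for `φ : X′ ⟶ X` flat, formally unramified and locally of finite type (e.g. étale, e.g. an open
immersion), `X` locally Noetherian, and a sequence of permissible blowing-ups `σ : Z ⟶ X` for `(J, b)` with last transform
`J′`, the fibre product `Z′ = Z ×_X X′ ⟶ X′` — assembled stage by stage from the cartesian squares
`Bl_{ψᵢ^* 𝓘_{Dᵢ}}(X′ᵢ) = Bl_{𝓘_{Dᵢ}}(Xᵢ) ×_{Xᵢ} X′ᵢ` — is a sequence of permissible blowing-ups for `(φ^*J, b)` with last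
transform `ψ^*J′`, `ψ : Z′ ⟶ Z` the (flat, unramified, locally finite-type) projection: the pulled-back centres
`ψᵢ⁻¹(Dᵢ)` are regular, reduced, inside the order-`≥ b` locus of the pulled-back transform (étale morphisms preserve
orders), the pulled-back blow-up is the blow-up of the pulled-back centre (flat base change), and the controlled
transforms are the pulled-back controlled transforms. [cite: BierstoneGrigorievMilmanWlodarczyk2011, Thm. 8.0.5] -/
theorem exists_isPullback_of_etale {Z : Scheme.{u}} {σ : Z ⟶ X} {J' : Z.IdealSheafData}
    (h : IsPermissibleBlowupSeq J b σ J') :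
    ∃ (Z' : Scheme.{u}) (σ' : Z' ⟶ X') (ψ : Z' ⟶ Z), IsPullback ψ σ' σ φ ∧ Flat ψ ∧
      FormallyUnramified ψ ∧ LocallyOfFiniteType ψ ∧ IsPermissibleBlowupSeq (J.comap φ) b σ' (J'.comap ψ) := by
  induction h with
  | nil =>
    exact ⟨X', 𝟙 X', φ, IsPullback.of_vert_isIso ⟨by simp⟩, inferInstance, inferInstance, inferInstance,
      IsPermissibleBlowupSeq.nil⟩
  | @blowup Z₁ Z₀ σ₀ J₀ h₀ D π hreg hD hπ ih =>
    obtain ⟨Z₀', σ₀', ψ₀, hpb₀, hfl, hur, hft, hseq⟩ := ih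
    haveI := hfl
    haveI := hur
    haveI := hft
    haveI : IsLocallyNoetherian Z₀ := h₀.isLocallyNoetherian inferInstance
    haveI : IsLocallyNoetherian Z₁ := (h₀.blowup D π hreg hD hπ).isLocallyNoetherian inferInstance
    haveI : IsLocallyNoetherian Z₀' := LocallyOfFiniteType.isLocallyNoetherian ψ₀
    -- the next stage `Z₁' = Z₁ ×_{Z₀} Z₀' = Bl_{ψ₀^* 𝓘_D}(Z₀')`
    haveI : Flat (pullback.fst π ψ₀) := MorphismProperty.pullback_fst _ _ hfl
    haveI : FormallyUnramified (pullback.fst π ψ₀) := MorphismProperty.pullback_fst _ _ hur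
    haveI : LocallyOfFiniteType (pullback.fst π ψ₀) := MorphismProperty.pullback_fst _ _ hft
    haveI : IsLocallyNoetherian (pullback π ψ₀) := LocallyOfFiniteType.isLocallyNoetherian (pullback.fst π ψ₀)
    -- the pulled-back centre: regular, hence the reduced ideal of its support `D' = ψ₀⁻¹ D`
    set C : Z₀'.IdealSheafData := (vanishingIdeal D).comap ψ₀ with hC
    have hCreg : Scheme.IsRegular C.subscheme := Scheme.IsRegular.subscheme_comap_of_etale ψ₀ _ hreg
    have hCeq : C = vanishingIdeal C.support := eq_vanishingIdeal_support_of_isRegular C hCreg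
    have hτ : IsBlowup (pullback.snd π ψ₀) C := hπ.of_isPullback_of_flat (IsPullback.of_hasPullback π ψ₀)
    have hreg' : Scheme.IsRegular (vanishingIdeal C.support).subscheme := by rw [← hCeq]; exact hCreg
    have hτ' : IsBlowup (pullback.snd π ψ₀) (vanishingIdeal C.support) := by rw [← hCeq]; exact hτ
    -- the pulled-back centre lies in the order-`≥ b` locus of the pulled-back transform (orders are preserved)
    have hD' : ∀ y ∈ (C.support : Set Z₀'), (b : ℕ∞) ≤ idealOrder (J₀.comap ψ₀) y := by
      intro y hy
      rw [hC, Scheme.IdealSheafData.support_comap] at hy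
      have hy' : ψ₀ y ∈ (D : Set Z₀) := by
        have : ψ₀ y ∈ ((vanishingIdeal D).support : Set Z₀) := hy
        rwa [Scheme.IdealSheafData.coe_support_vanishingIdeal] at this
      rw [idealOrder_comap_of_etale]
      exact hD _ hy'
    have step := hseq.blowup C.support (pullback.snd π ψ₀) hreg' hD' hτ'
    refine ⟨pullback π ψ₀, pullback.snd π ψ₀ ≫ σ₀', pullback.fst π ψ₀,
      (IsPullback.of_hasPullback π ψ₀).paste_vert hpb₀, inferInstance, inferInstance, inferInstance, ?_⟩
    rw [← hCeq] at step
    rwa [comap_controlledTransform_of_flat ψ₀ (pullback.condition (f := π) (g := ψ₀)) (vanishingIdeal D) J₀ b]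

end IsPermissibleBlowupSeq

namespace OrderReducible

variable {X X' : Scheme.{u}} (φ : X' ⟶ X) [Flat φ] [FormallyUnramified φ] [LocallyOfFiniteType φ]
  [IsLocallyNoetherian X] {I : X.IdealSheafData} {m : ℕ}

/-- **Γ-FREE ORDER REDUCIBILITY PULLS BACK ALONG ÉTALE MORPHISMS**: if `(X, I, m)` is order-reducible by a sequence of
permissible blowing-ups and `φ : X′ ⟶ X` is flat, formally unramified and locally of finite type (`X` locally
Noetherian), then `(X′, φ^*I, m)` is order-reducible — by the pulled-back sequence, whose last transform `ψ^*J′` has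
`ord_{x′} ψ^*J′ = ord_{ψ x′} J′ < m`. [cite: BierstoneGrigorievMilmanWlodarczyk2011, Thm. 8.0.5] -/
theorem comap_of_etale (h : OrderReducible I m) : OrderReducible (I.comap φ) m := by
  obtain ⟨Z, σ, J', hseq, hlt⟩ := h
  obtain ⟨Z', σ', ψ, -, hfl, hur, hft, hseq'⟩ := hseq.exists_isPullback_of_etale φ
  haveI := hfl
  haveI := hur
  haveI := hft
  refine ⟨Z', σ', J'.comap ψ, hseq', fun x => ?_⟩
  rw [idealOrder_comap_of_etale]
  exact hlt (ψ x)

omit [Flat φ] [FormallyUnramified φ] [LocallyOfFiniteType φ] in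
/-- **Order-reducibility restricts to open subschemes**: `OrderReducible I m → OrderReducible (I|_U) m` for every open
`U ⊆ X` of a locally Noetherian `X` (an open immersion is flat, unramified and locally of finite type).
[cite: BierstoneGrigorievMilmanWlodarczyk2011, Thm. 8.0.5] -/
theorem restrict (h : OrderReducible I m) (U : X.Opens) : OrderReducible (I.comap U.ι) m :=
  comap_of_etale U.ι h

end OrderReducible

end CampaignW46

end Summit.ResolutionOfSingularities.ResolutionOfSingularities.Theorems

end
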